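import Summits.NavierStokesRegularity.NavierStokesRegularity.Theorems.EpisodeInduction.Negative.GlobalDesigns
import Summits.NavierStokesRegularity.FluidComputer.AxisymNoSwirlForcedGlobal

/-!
# The FORCED no-swirl lever against the crux `EpisodeInduction`: K2G empties the axisymmetric
# swirl-free class at level 1 for ANY Clay force in the class

Cell `ns-blowup`, seat `ns-blowup-lean` (g9). Helper lemmas `--supports` the route item
`PalasekTowerBreakdown.EpisodeInduction` (:= `EpisodeInductionG`, stmt-NavierStokesRegularity-19178).
LABEL: E–C typing over landed theorems (KERNEL, no named fact). WHAT THIS IS NOT: not Navier–Stokes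
evidence — no schedule, stage, design or tower is constructed; no `¬ EpisodeInductionG` is claimed;
the existential premise of each lever is a registered level-1 stage nobody has exhibited.

Refuter g12's KJ-10 (`Theorems/EpisodeInduction/Negative/GlobalDesigns.lean`, p445785) emptied the
axisymmetric swirl-free class at level 1 under K2G only for UNFORCED designs
(`EpisodeInductionG.isEmpty_stage_of_noSwirl`, hypothesis `S.f = 0`, through the unforced
Ladyzhenskaya / Ukhovskii–Yudovich theorem `axisymmetric_no_swirl_global_regularity_holds`). With the
FORCED theorem (`FluidComputer/AxisymNoSwirlForcedGlobal.lean`: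
`PalasekTowerClayBridge.Realisation.not_axisym_noSwirl` — no tower realisation has axisymmetric
swirl-free datum AND force) the force hypothesis becomes «`S.f t` axisymmetric swirl-free for all
`t ≥ 0`», which every quiet or non-quiet axisymmetric swirl-free preparation force satisfies:

* `EpisodeInductionG.isEmpty_stage_of_noSwirl_forced` — under K2G, a pinned rigid quiet wide schedule
  whose datum `S.u₀` and force slices `S.f t` (`t ≥ 0`) are axisymmetric without swirl carries NO
  registered level-1 stage;
* `not_episodeInductionG_of_noSwirl_forced_design` — packaged: one such registered stage refutes K2G;
* by the route's decl names (namespace `Summit.NavierStokesRegularity.PalasekTowerBreakdownNegative`):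
  `palasekTowerBreakdown_not_episodeInduction_of_noSwirl_forced_design`,
  `palasekTowerBreakdown_not_heredity_pair_of_noSwirl_forced_design`.

References: O. A. Ladyzhenskaya, Zap. Naučn. Sem. LOMI 7 (1968); M. R. Ukhovskii, V. I. Yudovich,
J. Appl. Math. Mech. 32 (1968) — through P. G. Lemarié-Rieusset (2016), Thm 10.4
[cite: LemarieRieusset2016, Thm 10.4 (p. 285)]; S. Palasek, arXiv:2605.13827 §4
[cite: Palasek2026ElementaryModel, §4].
-/

noncomputable section

namespace Summit.NavierStokesRegularity.FluidComputer.PalasekTowerClayBridge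

open Set MeasureTheory Filter Topology Function
open scoped ENNReal ContDiff NNReal
open Literature.Analysis.FluidPDE

section Lever

/-- **K2G EMPTIES THE FORCED AXISYMMETRIC SWIRL-FREE CLASS AT LEVEL 1.** Under K2G, a pinned
(`Λ = 8`, `θ = 6/5`), rigid, quiet wide schedule whose datum `S.u₀` is axisymmetric without swirl and
whose force slices `S.f t` are axisymmetric without swirl for all `t ≥ 0` carries NO registered
(`Margins.routeG`) level-1 stage: the glued tower `Realisation.ofEpisodes` would be a realisation with
axisymmetric swirl-free datum and force (`Realisation.not_axisym_noSwirl`, the forced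
Ladyzhenskaya / Ukhovskii–Yudovich theorem); KJ-10's unforced `isEmpty_stage_of_noSwirl` is the
case `S.f = 0`. [cite: LemarieRieusset2016, Thm 10.4 (p. 285)] -/
theorem EpisodeInductionG.isEmpty_stage_of_noSwirl_forced (h₂ : EpisodeInductionG)
    {S : Schedule TowerRates.wide} (hP : S.Pins 8 (6 / 5)) (hR : S.Rigid) (hQ : S.Quiet)
    (hfA : ∀ t : ℝ, 0 ≤ t → IsAxisymmetric (S.f t)) (hfS : ∀ t : ℝ, 0 ≤ t → HasNoSwirl (S.f t))
    (hA : IsAxisymmetric S.u₀) (hS : HasNoSwirl S.u₀) :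
    IsEmpty (Stage 1 TowerRates.wide S (Margins.routeG TowerRates.wide) 1) := by
  refine ⟨fun s₁ => ?_⟩
  have step : ∀ n, ∀ s : Stage 1 TowerRates.wide S (Margins.routeG TowerRates.wide) (n + 1),
      ∃ s' : Stage 1 TowerRates.wide S (Margins.routeG TowerRates.wide) (n + 1 + 1), s.Extends s' :=
    fun n s => h₂ S hP hR hQ (n + 1) (by omega) s
  have hWf : (Realisation.ofEpisodes S s₁ step).f = S.f := Realisation.ofEpisodes_f S s₁ step
  have hu : (Realisation.ofEpisodes S s₁ step).u 0 = S.u₀ := Realisation.ofEpisodes_u_zero S s₁ step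
  refine (Realisation.ofEpisodes S s₁ step).not_axisym_noSwirl one_pos ⟨?_, ?_, ?_, ?_⟩
  · rw [hu]; exact hA
  · rw [hu]; exact hS
  · intro t ht
    rw [hWf]
    exact hfA t ht
  · intro t ht
    rw [hWf]
    exact hfS t ht

/-- **The forced no-swirl lever, packaged**: ONE registered level-1 stage of a pinned rigid quiet
wide schedule with axisymmetric swirl-free datum AND axisymmetric swirl-free force slices (`t ≥ 0`)
refutes K2G — fully kernel, no cap, no sign condition, no `S.f = 0`.
[cite: LemarieRieusset2016, Thm 10.4 (p. 285)] -/
theorem not_episodeInductionG_of_noSwirl_forced_design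
    (h : ∃ (S : Schedule TowerRates.wide)
      (_ : Stage 1 TowerRates.wide S (Margins.routeG TowerRates.wide) 1),
      S.Pins 8 (6 / 5) ∧ S.Rigid ∧ S.Quiet ∧
        (∀ t : ℝ, 0 ≤ t → IsAxisymmetric (S.f t)) ∧ (∀ t : ℝ, 0 ≤ t → HasNoSwirl (S.f t)) ∧
        IsAxisymmetric S.u₀ ∧ HasNoSwirl S.u₀) :
    ¬ EpisodeInductionG := by
  rintro h₂
  obtain ⟨S, s₁, hP, hR, hQ, hfA, hfS, hA, hS⟩ := h
  exact (h₂.isEmpty_stage_of_noSwirl_forced hP hR hQ hfA hfS hA hS).false s₁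

end Lever

end Summit.NavierStokesRegularity.FluidComputer.PalasekTowerClayBridge

/-! ## By the route's decl names -/

namespace Summit.NavierStokesRegularity.PalasekTowerBreakdownNegative

open Set
open Summit.NavierStokesRegularity.NavierStokesRegularity.Theses
open Summit.NavierStokesRegularity.FluidComputer.PalasekTowerClayBridge
open Literature.Analysis.FluidPDE

/-- **Item 19178 `PalasekTowerBreakdown.EpisodeInduction` is refuted by any registered axisymmetric
swirl-free level-1 design WITH an axisymmetric swirl-free Clay force** (route decl by name; body
`not_episodeInductionG_of_noSwirl_forced_design`). Premise not exhibited by anyone.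
[cite: LemarieRieusset2016, Thm 10.4 (p. 285)] -/
theorem palasekTowerBreakdown_not_episodeInduction_of_noSwirl_forced_design
    (h : ∃ (S : Schedule TowerRates.wide)
      (_ : Stage 1 TowerRates.wide S (Margins.routeG TowerRates.wide) 1),
      S.Pins 8 (6 / 5) ∧ S.Rigid ∧ S.Quiet ∧
        (∀ t : ℝ, 0 ≤ t → IsAxisymmetric (S.f t)) ∧ (∀ t : ℝ, 0 ≤ t → HasNoSwirl (S.f t)) ∧
        IsAxisymmetric S.u₀ ∧ HasNoSwirl S.u₀) :
    ¬ PalasekTowerBreakdown.EpisodeInduction :=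
  not_episodeInductionG_of_noSwirl_forced_design h

/-- **… hence such a design breaks the heredity PAIR of `closes`** (items 19249 ∧ 19250, through the
route's glue `EpisodeInductionGlueBy_holds`). [cite: LemarieRieusset2016, Thm 10.4 (p. 285)] -/
theorem palasekTowerBreakdown_not_heredity_pair_of_noSwirl_forced_design
    (h : ∃ (S : Schedule TowerRates.wide)
      (_ : Stage 1 TowerRates.wide S (Margins.routeG TowerRates.wide) 1),
      S.Pins 8 (6 / 5) ∧ S.Rigid ∧ S.Quiet ∧
        (∀ t : ℝ, 0 ≤ t → IsAxisymmetric (S.f t)) ∧ (∀ t : ℝ, 0 ≤ t → HasNoSwirl (S.f t)) ∧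
        IsAxisymmetric S.u₀ ∧ HasNoSwirl S.u₀) :
    ¬ (PalasekTowerBreakdown.HeredityAtOne ∧ PalasekTowerBreakdown.HeredityFromTwo) := by
  rintro ⟨h₁, h₂⟩
  exact palasekTowerBreakdown_not_episodeInduction_of_noSwirl_forced_design h
    (PalasekTowerBreakdown.EpisodeInductionGlueBy_holds h₁ h₂)

end Summit.NavierStokesRegularity.PalasekTowerBreakdownNegative

end
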